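import Summits.CriticalPhenomena.SAWScalingLimit.Theorems.SAWTensorRGRestrictionOfLimitOfConfCov
import Summits.CriticalPhenomena.SAWScalingLimit.Theorems.SAWTensorRGRestrictionOfLimitOfContinuityOfLimit
import Summits.CriticalPhenomena.SAWScalingLimit.Theorems.SAWTensorRGRestrictionOfLimitOfDiscContinuity
import HarnessLib

/-!
# Strategy census (crux-strategist s2) for `RestrictionOfLimit` (stmt-CriticalPhenomena-0773) — typed attempts

Companion of `STRATEGY-CENSUS.md`.  Nothing here is a new line or a stub: it records, as elaborating Lean
statements, (1) the DOMINANCE of the crux by its co-cruxes (landed bridges, restated by name), (2) the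
NEGATION heading (a counterexample needs an inhabitant of `SAW.IsScalingLimitFamily` and refutes
conformal covariance of the SAW limit), (3) the STRENGTHEN / TRANSFER headings' candidate statements
(`NullTouchAll`, `EquicontinuousAvoidance`) so that the census is about precise objects.
-/

noncomputable section

open MeasureTheory Filter Topology Set Metric
open scoped ENNReal
open Literature.Probability.RandomPlanarGeometry Literature.Probability.LatticeModels

namespace Summit.CriticalPhenomena.SAWScalingLimit.Cruxes.RestrictionOfLimit.Census

open Summit.CriticalPhenomena.SAWScalingLimit.Theses
open Summit.CriticalPhenomena.SAWScalingLimit.Theorems.RestrictionOfLimit.Birth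

/-! ### 1. Dominance: the crux sits below existing co-cruxes by LANDED theorems -/

/-- stmt-0771 ⇒ stmt-0773 (p172190). -/
theorem dominated_by_confCovLimit :
    SAWConfRestriction.ConfCovLimit → SAWConfRestriction.RestrictionOfLimit :=
  stub_restrictionOfLimitOfConfCovLimit

/-- stmt-7305 ⇒ stmt-0773 (p172244). -/
theorem dominated_by_continuityOfLimit :
    SAWConePseudogroup.ContinuityOfLimit → SAWConePseudogroup.RestrictionOfLimit :=
  stub_restrictionOfLimitOfContinuityOfLimit

/-- stmt-6755 ⇒ stmt-0773 (p168098). -/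
theorem dominated_by_discContinuity :
    SAWExpCovariance.DiscContinuity → SAWConfRestriction.RestrictionOfLimit :=
  stub_restrictionOfLimitOfDiscContinuity

/-- The five route copies are one statement (definitional equality of the decl bodies). -/
example : SAWConePseudogroup.RestrictionOfLimit = SAWConfRestriction.RestrictionOfLimit := rfl
example : SAWTensorRG.RestrictionOfLimit = SAWConfRestriction.RestrictionOfLimit := rfl
example : SAWBrownianDomination.RestrictionOfLimit = SAWConfRestriction.RestrictionOfLimit := rfl
example : SAWTowerCount.RestrictionOfLimit = SAWConfRestriction.RestrictionOfLimit := rfl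

/-! ### 2. Negation heading: what a counterexample would have to be -/

/-- A refutation of the crux refutes conformal covariance of the SAW scaling limit (contrapositive of the
landed bridge): the negation is at least as hard as deciding `ConfCovLimit` negatively. -/
theorem not_confCovLimit_of_not_restrictionOfLimit :
    ¬ SAWConfRestriction.RestrictionOfLimit → ¬ SAWConfRestriction.ConfCovLimit :=
  mt dominated_by_confCovLimit

/-- … and refutes Radó continuity of the limit (route SAWConePseudogroup's own r4). -/
theorem not_continuityOfLimit_of_not_restrictionOfLimit :
    ¬ SAWConePseudogroup.RestrictionOfLimit → ¬ SAWConePseudogroup.ContinuityOfLimit :=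
  mt dominated_by_continuityOfLimit

/-- A counterexample needs THE scaling limit of the critical `δℤ²` SAW to exist (the binder of the crux is
inhabited only by it, `SAW.IsScalingLimitFamily.unique`): no witness can be built in the tree while
`LimitExists` (stmt-1371) is open. -/
theorem exists_scalingLimit_of_not_restrictionOfLimit :
    ¬ SAWConfRestriction.RestrictionOfLimit → ∃ P : ChordalFamily, SAW.IsScalingLimitFamily P := by
  intro h
  by_contra hne
  push Not at hne
  exact h fun P hch hlim => absurd (show SAW.IsScalingLimitFamily P from ⟨hch, hlim⟩) (hne P)

/-! ### 3. Strengthen heading: the rigid forms, typed -/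

/-- S⁺₁ — NO ATOM ANYWHERE: the abstract SAW limit in `D`, on the event `{γ ⊆ cl D'}`, gives zero mass to
touching ANY compact part of the defect `cl (D ∖ D')` that avoids the two marked points (for hull pairs take
`K = cl (D ∖ D')`: this is the live line's `stub_nullTouchHull`).  Stronger than what composition 1 needs,
and NOT easier: it is the same missing a-priori estimate with one more quantifier; its only soft consequence
(countably many exceptional members in a separated family) is already landed (p151626). -/
def NullTouchAll : Prop :=
  ∀ P : ChordalFamily, SAW.IsScalingLimitFamily P →
    ∀ (D D' : DobrushinDomain), D'.carrier ⊆ D.carrier → D'.pt 0 = D.pt 0 → D'.pt 1 = D.pt 1 →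
      ∀ K : Set ℂ, IsCompact K → K ⊆ closure (D.carrier \ D'.carrier) → D.pt 0 ∉ K → D.pt 1 ∉ K →
        P D (CurveClass.rangeSubset (closure D'.carrier) ∩ {γ : CurveClass ℂ | (γ.range ∩ K).Nonempty}) = 0

/-- S⁺₁ contains the live line's hull stub (so it is a strengthening, not a side statement). -/
theorem nullTouchHull_of_nullTouchAll (h : NullTouchAll) :
    ∀ P : ChordalFamily, SAW.IsScalingLimitFamily P →
      ∀ (D D' : DobrushinDomain), D.IsHullSubdomain D' →
        P D (CurveClass.rangeSubset (closure D'.carrier) ∩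
          {γ : CurveClass ℂ | (γ.range ∩ closure (D.carrier \ D'.carrier)).Nonempty}) = 0 := by
  intro P hP D D' hH
  obtain ⟨hsub, h0, h1, ha, hb⟩ := hH
  refine h P hP D D' hsub h0 h1 _ ?_ subset_rfl ha hb
  exact (D.isBounded.subset sdiff_subset).isCompact_closure

/-! ### 4. Transfer heading: the crux moved to the finite-volume walk, typed -/

/-- T — EQUICONTINUITY OF LATTICE AVOIDANCE (the language switch "abstract limit ↦ lattice walk"): for a hull
pair, uniformly in small mesh, the critical SAW of `D_δ` from `a_δ` to `b_δ` is unlikely to come `η`-close to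
the defect `cl (D ∖ D')` while never entering it deeper than `η`.  With the landed open-set portmanteau
`le_liminf_law_preimage_of_isOpen` (p148885) this gives `stub_nullTouchHull` (the touching event lies in every
open event below).  It is the conditional boundary-grazing estimate that SAW lacks a tool for (no RSW / FKG /
quasi-multiplicativity; unfolding needs half-planes; extremal-point surgery gains `Σ x_c^{2k} < ∞`, i.e. O(1)). -/
def EquicontinuousAvoidance : Prop :=
  ∀ (D D' : DobrushinDomain), D.IsHullSubdomain D' →
    ∀ ε : ℝ, 0 < ε → ∃ η : ℝ, 0 < η ∧
      ∀ (a b : ℝ → Site 2), SAW.IsEndpointApprox D a b →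
        ∀ᶠ δ in 𝓝[>] (0 : ℝ),
          SAW.law D.carrier δ (a δ) (b δ)
            {γ : SAW.DomainSAW D.carrier δ (a δ) (b δ) |
              γ.curve.range ⊆ thickening η D'.carrier ∧
                (γ.curve.range ∩ thickening η (closure (D.carrier \ D'.carrier))).Nonempty} ≤
            ENNReal.ofReal ε

/-- The open events of the transfer contain the touching event, for every `η > 0` (the set-theoretic half of
"equicontinuity ⇒ null touching"; the measure half is the landed portmanteau). -/
theorem touch_subset_graze {D D' : DobrushinDomain} {η : ℝ} (hη : 0 < η) :
    CurveClass.rangeSubset (closure D'.carrier) ∩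
        {γ : CurveClass ℂ | (γ.range ∩ closure (D.carrier \ D'.carrier)).Nonempty} ⊆
      {γ : CurveClass ℂ | γ.range ⊆ thickening η D'.carrier ∧
        (γ.range ∩ thickening η (closure (D.carrier \ D'.carrier))).Nonempty} := by
  rintro γ ⟨hR, z, hzγ, hzF⟩
  have hR' : γ.range ⊆ closure D'.carrier := by simpa using hR
  refine ⟨?_, z, hzγ, Metric.self_subset_thickening hη _ hzF⟩
  intro w hw
  exact Metric.closure_subset_thickening hη D'.carrier (hR' hw)

end Summit.CriticalPhenomena.SAWScalingLimit.Cruxes.RestrictionOfLimit.Census
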